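import Summits.KontsevichZagierPeriods.KontsevichZagierPeriods.Theorems.HermiteRigidityReductionRigidityJoinValueNegLevel
import Summits.KontsevichZagierPeriods.KontsevichZagierPeriods.Theorems.HermiteRigidityDilogRigidityCubeSeriesLevel
import Mathlib.MeasureTheory.Integral.Pi
import Mathlib.MeasureTheory.Integral.DominatedConvergence
import Mathlib.Analysis.SpecificLimits.Basic
import Mathlib.Analysis.SpecificLimits.Normed
import Mathlib.Analysis.SpecialFunctions.Integrals.Basic

/-!
# `ReductionRigidity` (stmt-KontsevichZagierPeriods-3407), line `Sketch` (cycle-3 growth: the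
# DUPLICATION JOIN island): stubs `stub_dupJoinValueNegOne`, `stub_dupJoinValueNegTwo`

THE VALUES OF THE WEIGHT-ONE AND WEIGHT-TWO NORMAL FORMS AT THE NEGATIVE LEVEL `−N`. For a natural
`N ≥ 2`,

  `∫_{[0,1]} dx / ((−N) − x) = ∑_{k ≥ 0} (−1/N)^{k+1} / (k+1)   (= Li₁(−1/N) = −log(1 + 1/N))`,
  `∫_{[0,1]²} dx dy / ((−N) − x y) = ∑_{k ≥ 0} (−1/N)^{k+1} / (k+1)²   (= Li₂(−1/N))`,

the two negative-level numbers of the five-term rigidity `1, Li₁(1/N), Li₂(1/N), Li₁(−1/N),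
Li₂(−1/N)` behind the duplication join island.

Both are the every-dimension series at a real level OF EITHER SIGN,
`integral_cube_one_div_prod_absLevel`: for `|ν| > 1` and every dimension `i`,
`∫_{[0,1]^i} dx/(ν − ∏_l x_l) = ∑_k (1/ν)^{k+1}/(k+1)^i`, the signed companion of the landed
`stub_cubeIntegralSeriesLevel` (`ν ≥ 2`, `HermiteRigidityDilogRigidityCubeSeriesLevel.lean`) and the
every-dimension form of the landed `integral_cube_two_one_div_absLevel`
(`HermiteRigidityReductionRigidityJoinValueNegLevel.lean`, used verbatim for the weight-two value):
on the cube `u = ∏_l x_l ∈ [0, 1]`, so `|u/ν| ≤ 1/|ν| < 1` and the geometric expansion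
`1/(ν − u) = ∑_k (1/ν)^{k+1} u^k` (`hasSum_geometric_of_abs_lt_one`) is absolutely convergent
(alternating for `ν < 0`); `∫` and `∑` are swapped by
`MeasureTheory.integral_tsum_of_summable_integral_norm`, the norms of the terms integrating to
`|1/ν|^{k+1}/(k+1)^i ≤ |1/ν|^{k+1}`, a summable geometric bound; termwise,
`∫_{[0,1]^i} (∏_l x_l)^k = 1/(k+1)^i` is the landed `integral_cube_prod_pow`. Finally
`1/(−N) = −(1/N)` (`one_div_neg_eq_neg_one_div`).
-/

noncomputable section

open MeasureTheory Set

namespace Summit.KontsevichZagierPeriods.HermiteRigidity.ReductionRigidity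

open Literature.NumberTheory.Transcendental
open Literature.NumberTheory.Transcendental.KZ

/-! ## The series `∫_{[0,1]^i} dx/(ν − ∏ x) = ∑_k ν^{-(k+1)}/(k+1)^i` for real `|ν| > 1` -/

/-- **The weight-`i` normal form as a polylogarithm series, real level of either sign**: for every
dimension `i` and every real `ν` with `|ν| > 1`,
`∫_{[0,1]^i} dx/(ν − ∏_l x_l) = ∑_{k ≥ 0} (1/ν)^{k+1}/(k+1)^i (= Li_i(1/ν))`, by termwise
integration of the geometric expansion `1/(ν − u) = ∑_k u^k/ν^{k+1}`, `u = ∏_l x_l`, absolutely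
convergent on the closed cube since `|u/ν| ≤ 1/|ν| < 1`. [folklore] -/
theorem integral_cube_one_div_prod_absLevel (i : ℕ) (ν : ℝ) (hν : 1 < |ν|) :
    ∫ p in cube i, 1 / (ν - ∏ l, p l) = ∑' k : ℕ, (1 / ν) ^ (k + 1) / ((k : ℝ) + 1) ^ i := by
  have hνabs : (0 : ℝ) < |ν| := by linarith
  have hνne : ν ≠ 0 := abs_pos.mp hνabs
  -- the ratio of the dominating geometric series
  have hρ1 : |1 / ν| < 1 := by
    rw [abs_div, abs_one, div_lt_one hνabs]
    exact hν
  -- the terms of the expansion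
  set F : ℕ → (Fin i → ℝ) → ℝ := fun k p => (1 / ν) ^ (k + 1) * (∏ l, p l) ^ k with hF
  -- bounds on `u = ∏ x` on the cube
  have hu : ∀ p ∈ cube i, 0 ≤ ∏ l, p l ∧ ∏ l, p l ≤ 1 := fun p hp =>
    prod_mem_unitInterval_of_mem_cube hp
  -- pointwise (absolutely convergent) geometric expansion on the cube
  have hexp : EqOn (fun p : Fin i → ℝ => 1 / (ν - ∏ l, p l)) (fun p => ∑' k, F k p)
      (cube i) := by
    intro p hp
    obtain ⟨h0, h1⟩ := hu p hp
    have hr : |(∏ l, p l) / ν| < 1 := by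
      rw [abs_div, abs_of_nonneg h0, div_lt_one hνabs]
      linarith
    have hne : ν - ∏ l, p l ≠ 0 := by
      intro h
      have hνeq : ν = ∏ l, p l := by linarith
      rw [hνeq, abs_of_nonneg h0] at hν
      linarith
    have hgeom := (hasSum_geometric_of_abs_lt_one hr).mul_left (1 / ν)
    have hval : 1 / ν * (1 - (∏ l, p l) / ν)⁻¹ = 1 / (ν - ∏ l, p l) := by
      field_simp
    have hterm : (fun k : ℕ => 1 / ν * ((∏ l, p l) / ν) ^ k) = fun k => F k p := by
      funext k
      simp only [hF]
      ring
    rw [hval, hterm] at hgeom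
    exact hgeom.tsum_eq.symm
  -- each term is integrable on the cube
  have hint : ∀ k, Integrable (F k) (volume.restrict (cube i)) := by
    intro k
    have hc : Continuous (F k) := by
      simp only [hF]
      fun_prop
    exact hc.continuousOn.integrableOn_compact isCompact_cube
  -- the value of each termwise integral
  have hval : ∀ k, ∫ p in cube i, F k p = (1 / ν) ^ (k + 1) / ((k : ℝ) + 1) ^ i := by
    intro k
    simp only [hF]
    rw [integral_const_mul, integral_cube_prod_pow, mul_one_div]
  -- the norms: `‖F k p‖ = |1/ν|^(k+1) (∏ x)^k` on the cube
  have hnorm : ∀ k, ∫ p in cube i, ‖F k p‖ = |1 / ν| ^ (k + 1) / ((k : ℝ) + 1) ^ i := by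
    intro k
    have h : ∫ p in cube i, ‖F k p‖ = ∫ p in cube i, |1 / ν| ^ (k + 1) * (∏ l, p l) ^ k := by
      refine setIntegral_congr_fun measurableSet_cube fun p hp => ?_
      simp only [hF]
      rw [Real.norm_eq_abs, abs_mul, abs_pow, abs_pow, abs_of_nonneg (hu p hp).1]
    rw [h, integral_const_mul, integral_cube_prod_pow, mul_one_div]
  -- summability of the norms: dominated by the geometric series `∑ |1/ν|^(k+1)`
  have hsum : Summable fun k => ∫ p in cube i, ‖F k p‖ := by
    simp_rw [hnorm]
    have hρ0 : 0 ≤ |1 / ν| := abs_nonneg _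
    have hg : Summable fun k : ℕ => |1 / ν| * |1 / ν| ^ k :=
      (summable_geometric_of_lt_one hρ0 hρ1).mul_left _
    refine Summable.of_nonneg_of_le (fun k => by positivity) (fun k => ?_) hg
    rw [← pow_succ']
    have hk : (1 : ℝ) ≤ ((k : ℝ) + 1) ^ i :=
      one_le_pow₀ (by linarith [(k.cast_nonneg : (0 : ℝ) ≤ k)])
    exact div_le_self (pow_nonneg hρ0 (k + 1)) hk
  -- termwise integration
  rw [setIntegral_congr_fun measurableSet_cube hexp,
    ← integral_tsum_of_summable_integral_norm hint hsum]
  exact tsum_congr hval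

/-! ## The negative integer level `ν = −N`, `N ≥ 2` -/

/-- **V1, the value of the weight-one normal form at the negative level `−N`**: for a natural
`N ≥ 2`, `∫_{[0,1]} dx/((−N) − x) = ∑_{k ≥ 0} (−1/N)^{k+1}/(k+1) (= Li₁(−1/N) = −log(1 + 1/N))`,
the dimension-one case of `integral_cube_one_div_prod_absLevel` at `ν = −N`, `|ν| = N ≥ 2 > 1`,
with `∏_{l : Fin 1} p l = p 0` and `1/(−N) = −(1/N)`. [folklore] -/
theorem stub_dupJoinValueNegOne : ∀ (N : ℕ), 2 ≤ N →
    ∫ p in cube 1, 1 / ((-(N : ℝ)) - p 0) = ∑' k : ℕ, (-(1 / (N : ℝ))) ^ (k + 1) / ((k : ℝ) + 1) := by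
  intro N hN
  have hN' : (2 : ℝ) ≤ (N : ℝ) := by exact_mod_cast hN
  have hν : 1 < |(-(N : ℝ))| := by
    rw [abs_neg, abs_of_nonneg (by linarith)]
    linarith
  have h := integral_cube_one_div_prod_absLevel 1 (-(N : ℝ)) hν
  simp only [Fin.prod_univ_one, pow_one] at h
  rw [h, one_div_neg_eq_neg_one_div]

/-- **V2, the value of the weight-two normal form at the negative level `−N`**: for a natural
`N ≥ 2`, `∫_{[0,1]²} dx dy/((−N) − x y) = ∑_{k ≥ 0} (−1/N)^{k+1}/(k+1)² (= Li₂(−1/N))`, the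
landed real-level series `integral_cube_two_one_div_absLevel` at `ν = −N`, `|ν| = N ≥ 2 > 1`, with
`1/(−N) = −(1/N)`. [folklore] -/
theorem stub_dupJoinValueNegTwo : ∀ (N : ℕ), 2 ≤ N →
    ∫ p in cube 2, 1 / ((-(N : ℝ)) - p 0 * p 1) = ∑' k : ℕ, (-(1 / (N : ℝ))) ^ (k + 1) / ((k : ℝ) + 1) ^ 2 := by
  intro N hN
  have hN' : (2 : ℝ) ≤ (N : ℝ) := by exact_mod_cast hN
  have hν : 1 < |(-(N : ℝ))| := by
    rw [abs_neg, abs_of_nonneg (by linarith)]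
    linarith
  rw [integral_cube_two_one_div_absLevel _ hν, one_div_neg_eq_neg_one_div]

end Summit.KontsevichZagierPeriods.HermiteRigidity.ReductionRigidity
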